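import Summits.CriticalPhenomena.CardyFormulaZ2.Theorems.CardyIKTransportIKMixedBoxCrossingQuenchedMixtureDefs
import Mathlib.Combinatorics.SetFamily.FourFunctions

/-!
# Stub `stub_quenchedHarris` (line `defect-closure-exploration` v7, crux `IKMixedBoxCrossing`, stmt-CriticalPhenomena-5911)

Support file (`--supports stmt-CriticalPhenomena-5911`): the quenched-mixture layer (H) of skeleton v7
(`…IKMixedBoxCrossingQuenchedMixtureDefs`): `QuenchedLogSupermodular → QuenchedHarris`.

Proof.  (1) TOTAL MASS `quenchedProb D Λ v Λ.powerset = 1` (`quenchedProb_powerset`): for `D ⊆ innerVertices Λ` the box `Λ`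
is partitioned into the free cells and the (pairwise disjoint) component cell sets `K ∈ comps D`
(`eq_freeCells_union_biUnion_comps`, `comps_disjoint`), so the sum over `s ⊆ Λ` of the product weight factorises
(`sum_powerset_prod_blocks`, induction on the blocks via `Finset.powerset_union`); each chain factor sums to
`1/V + (V − 2)/V + 1/V = 1` (`sum_powerset_chainW`) and the free factor to `2^{|free|} · 2^{-|free|} = 1`.
(2) TWO EVENTS (`harris_two`): Mathlib's Four Functions Theorem on the powerset algebra (`Finset.four_functions_theorem`)
with all four functions equal to the (nonnegative, by hypothesis log-supermodular) quenched weight gives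
`P(A) P(B) ≤ P(A ⊼ B) P(A ⊻ B) ≤ 1 · P(A ∩ B)` for up-sets `A, B ⊆ Λ.powerset` (`A ⊻ B ⊆ A ∩ B`, total mass `1`).
(3) Induction on the number `k` of events (`Fin.prod_univ_castSucc`).  No new definitions.
-/

noncomputable section

namespace Summit.CriticalPhenomena.CardyFormulaZ2.Cruxes.IKMixedBoxCrossing.QuenchedChainFKG

open scoped Classical BigOperators FinsetFamily
open Finset
open Literature.Probability.LatticeModels

namespace QuenchedHarrisProof

/-! ## §1 Components: membership, disjointness, the partition of the box -/

/-- Membership in a component cell set: `x` lies in the block of a face reachable from `g`. -/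
theorem mem_compCells {D : Finset (Site 2)} {g : {g // g ∈ D}} {x : Site 2} :
    x ∈ compCells D g ↔ ∃ g' : {g // g ∈ D}, (defectGraph D).Reachable g g' ∧ x ∈ cellFace g'.1 := by
  simp only [compCells, mem_biUnion, mem_filter, mem_attach, true_and]

/-- Faces whose blocks meet are in the same component. -/
theorem reachable_of_inter_nonempty {D : Finset (Site 2)} {a b : {g // g ∈ D}}
    (h : (cellFace a.1 ∩ cellFace b.1).Nonempty) : (defectGraph D).Reachable a b := by
  by_cases hab : a = b
  · subst hab
    exact SimpleGraph.Reachable.refl _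
  · exact SimpleGraph.Adj.reachable ((SimpleGraph.fromRel_adj _ _ _).2 ⟨hab, Or.inl h⟩)

/-- Reachable faces have the same component cell set. -/
theorem compCells_eq_of_reachable {D : Finset (Site 2)} {a b : {g // g ∈ D}} (h : (defectGraph D).Reachable a b) :
    compCells D a = compCells D b := by
  unfold compCells
  rw [filter_congr fun g _ => show (defectGraph D).Reachable a g ↔ (defectGraph D).Reachable b g from
    ⟨fun ha => h.symm.trans ha, fun hb => h.trans hb⟩]

/-- Distinct component cell sets are disjoint. -/
theorem comps_disjoint {D : Finset (Site 2)} {K K' : Finset (Site 2)} (hK : K ∈ comps D) (hK' : K' ∈ comps D)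
    (hne : K ≠ K') : Disjoint K K' := by
  simp only [comps, mem_image, mem_attach, true_and] at hK hK'
  obtain ⟨a, rfl⟩ := hK
  obtain ⟨b, rfl⟩ := hK'
  rw [disjoint_left]
  intro x hxa hxb
  apply hne
  obtain ⟨a', haa', hxa'⟩ := mem_compCells.1 hxa
  obtain ⟨b', hbb', hxb'⟩ := mem_compCells.1 hxb
  exact compCells_eq_of_reachable
    (haa'.trans ((reachable_of_inter_nonempty ⟨x, mem_inter.2 ⟨hxa', hxb'⟩⟩).trans hbb'.symm))

/-- Component cell sets of a defect set inside `Λ` lie in `Λ`. -/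
theorem comps_subset {D Λ : Finset (Site 2)} (hD : D ⊆ innerVertices Λ) {K : Finset (Site 2)} (hK : K ∈ comps D) :
    K ⊆ Λ := by
  simp only [comps, mem_image, mem_attach, true_and] at hK
  obtain ⟨a, rfl⟩ := hK
  intro x hx
  obtain ⟨a', -, hxa'⟩ := mem_compCells.1 hx
  exact mem_innerVertices_iff.1 (hD a'.2) hxa'

/-- Component cell sets avoid the free cells. -/
theorem disjoint_freeCells {D Λ K : Finset (Site 2)} (hK : K ∈ comps D) : Disjoint K (freeCells D Λ) := by
  simp only [comps, mem_image, mem_attach, true_and] at hK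
  obtain ⟨a, rfl⟩ := hK
  rw [disjoint_left]
  intro x hx hxF
  obtain ⟨a', -, hxa'⟩ := mem_compCells.1 hx
  exact (mem_filter.1 hxF).2 a'.1 a'.2 hxa'

/-- THE PARTITION OF THE BOX: `Λ` is the union of its free cells and the component cell sets. -/
theorem eq_freeCells_union_biUnion_comps {D Λ : Finset (Site 2)} (hD : D ⊆ innerVertices Λ) :
    Λ = freeCells D Λ ∪ (comps D).biUnion id := by
  ext x
  simp only [mem_union, mem_biUnion, id]
  constructor
  · intro hx
    by_cases h : ∃ g ∈ D, x ∈ cellFace g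
    · obtain ⟨g, hg, hxg⟩ := h
      exact Or.inr ⟨compCells D ⟨g, hg⟩, mem_image_of_mem _ (mem_attach _ _),
        mem_compCells.2 ⟨⟨g, hg⟩, SimpleGraph.Reachable.refl _, hxg⟩⟩
    · exact Or.inl (mem_filter.2 ⟨hx, fun g hg hxg => h ⟨g, hg, hxg⟩⟩)
  · rintro (hx | ⟨K, hK, hxK⟩)
    · exact (mem_filter.1 hx).1
    · exact comps_subset hD hK hxK

/-! ## §2 Patterns, local codes, nonnegativity -/

/-- A pattern picks, on every component, a local codeword that is neither empty nor full. -/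
theorem apply_mem_of_mem_patterns {D : Finset (Site 2)} {v : Finset (Site 2) → Finset (Site 2)} (hv : v ∈ patterns D)
    {K : Finset (Site 2)} (hK : K ∈ comps D) : v K ∈ localCode D K ∧ v K ≠ ∅ ∧ v K ≠ K := by
  simp only [patterns, mem_image] at hv
  obtain ⟨f, hf, rfl⟩ := hv
  have h := mem_pi.1 hf K hK
  simp only [mem_erase] at h
  simp only [dif_pos hK]
  exact ⟨h.2.2, h.2.1, h.1⟩

/-- The empty (all-white) local black set is a codeword. -/
theorem empty_mem_localCode (D K : Finset (Site 2)) : ∅ ∈ localCode D K := by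
  refine mem_filter.2 ⟨empty_mem_powerset _, fun g _ _ => ?_⟩
  have : (fun x => decide (x ∈ (∅ : Finset (Site 2)))) = fun _ => false := funext fun x => by simp
  rw [this]
  exact not_isOddFace_white g

/-- When a pattern exists, every local code has at least two words. -/
theorem two_le_card_localCode {D : Finset (Site 2)} {v : Finset (Site 2) → Finset (Site 2)} (hv : v ∈ patterns D)
    {K : Finset (Site 2)} (hK : K ∈ comps D) : 2 ≤ (localCode D K).card := by
  obtain ⟨h1, h2, -⟩ := apply_mem_of_mem_patterns hv hK
  exact one_lt_card.2 ⟨v K, h1, ∅, empty_mem_localCode D K, h2⟩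

/-- The quenched weight of an admissible environment is nonnegative. -/
theorem quenchedW_nonneg {D Λ : Finset (Site 2)} {v : Finset (Site 2) → Finset (Site 2)} (hv : v ∈ patterns D)
    (s : Finset (Site 2)) : 0 ≤ quenchedW D Λ v s := by
  unfold quenchedW
  split_ifs
  · exact mul_nonneg (by positivity)
      (prod_nonneg fun K hK => chainW_nonneg (two_le_card_localCode hv hK) _ _ _)
  · exact le_rfl

/-! ## §3 Total mass -/

/-- On its three-point chain `∅ ⊂ vK ⊂ K` the chain weight sums to `1/V + (V − 2)/V + 1/V = 1`. -/
theorem sum_powerset_chainW {V : ℕ} (hV : V ≠ 0) {K vK : Finset (Site 2)} (hvK : vK ⊆ K) (h0 : vK ≠ ∅) (h1 : vK ≠ K) :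
    ∑ τ ∈ K.powerset, chainW V K vK τ = 1 := by
  have hK : K ≠ ∅ := fun h => h0 (subset_empty.1 (h ▸ hvK))
  have hsub : ({∅, vK, K} : Finset (Finset (Site 2))) ⊆ K.powerset := by
    intro τ hτ
    simp only [mem_insert, mem_singleton] at hτ
    rw [mem_powerset]
    rcases hτ with rfl | rfl | rfl
    · exact empty_subset _
    · exact hvK
    · exact Subset.rfl
  rw [← sum_subset hsub fun τ _ hτ => ?_]
  · rw [sum_insert (by simp [Ne.symm h0, Ne.symm hK]), sum_pair h1]
    simp only [chainW, h0, h1, hK, if_true, if_false]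
    have hV' : (V : ℝ) ≠ 0 := by exact_mod_cast hV
    field_simp
    ring
  · simp only [mem_insert, mem_singleton, not_or] at hτ
    exact chainW_eq_zero hτ.1 hτ.2.2 hτ.2.1

/-- A union of parts of two disjoint sets traces back its parts. -/
theorem union_inter_eq_left {a b s : Finset (Site 2)} (ha : a ⊆ s) (hb : Disjoint b s) : (a ∪ b) ∩ s = a := by
  rw [union_inter_distrib_right, inter_eq_left.2 ha, disjoint_iff_inter_eq_empty.1 hb, union_empty]

/-- Summing over the subsets of a disjoint union = summing over pairs of subsets. -/
theorem sum_powerset_union_disjoint {s t : Finset (Site 2)} (h : Disjoint s t) (f : Finset (Site 2) → ℝ) :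
    ∑ u ∈ (s ∪ t).powerset, f u = ∑ a ∈ s.powerset, ∑ b ∈ t.powerset, f (a ∪ b) := by
  rw [powerset_union, ← image_sup_product, sum_image, sum_product]
  · rfl
  · rintro ⟨a, b⟩ hab ⟨a', b'⟩ hab' heq
    simp only [coe_product, Set.mem_prod, mem_coe, mem_powerset] at hab hab'
    change a ∪ b = a' ∪ b' at heq
    have ha : a = a' := by
      rw [← union_inter_eq_left hab.1 (h.symm.mono_left hab.2), heq, union_inter_eq_left hab'.1 (h.symm.mono_left hab'.2)]
    have hb : b = b' := by
      rw [← union_inter_eq_left hab.2 (h.mono_left hab.1), union_comm, heq, union_comm,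
        union_inter_eq_left hab'.2 (h.mono_left hab'.1)]
    rw [ha, hb]

/-- BLOCK FACTORISATION: over the subsets of `F ⊔ ⨆ 𝒦` (pairwise disjoint blocks `𝒦`, each carrying a weight of total mass `1`
read on the trace), the product weight sums to `2^{|F|}`. -/
theorem sum_powerset_prod_blocks (F : Finset (Site 2)) (w : Finset (Site 2) → Finset (Site 2) → ℝ)
    (𝒦 : Finset (Finset (Site 2))) (hdisj : ∀ K ∈ 𝒦, ∀ K' ∈ 𝒦, K ≠ K' → Disjoint K K')
    (hF : ∀ K ∈ 𝒦, Disjoint K F) (hw : ∀ K ∈ 𝒦, ∑ τ ∈ K.powerset, w K τ = 1) :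
    ∑ s ∈ (F ∪ 𝒦.biUnion id).powerset, ∏ K ∈ 𝒦, w K (s ∩ K) = 2 ^ F.card := by
  induction 𝒦 using Finset.induction_on with
  | empty => simp [card_powerset]
  | insert K₀ 𝒦 hK₀ ih =>
    have hdisj' : ∀ K ∈ 𝒦, Disjoint K₀ K := fun K hK =>
      hdisj K₀ (mem_insert_self _ _) K (mem_insert_of_mem hK) fun h => hK₀ (h ▸ hK)
    have hΛ' : Disjoint K₀ (F ∪ 𝒦.biUnion id) := by
      rw [disjoint_union_right, disjoint_biUnion_right]
      exact ⟨hF K₀ (mem_insert_self _ _), fun K hK => hdisj' K hK⟩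
    have ih' := ih (fun K hK K' hK' hne => hdisj K (mem_insert_of_mem hK) K' (mem_insert_of_mem hK') hne)
      (fun K hK => hF K (mem_insert_of_mem hK)) fun K hK => hw K (mem_insert_of_mem hK)
    rw [biUnion_insert, id_eq, union_left_comm, sum_powerset_union_disjoint hΛ']
    calc ∑ τ ∈ K₀.powerset, ∑ s' ∈ (F ∪ 𝒦.biUnion id).powerset, ∏ K ∈ insert K₀ 𝒦, w K ((τ ∪ s') ∩ K)
        = ∑ τ ∈ K₀.powerset, ∑ s' ∈ (F ∪ 𝒦.biUnion id).powerset, w K₀ τ * ∏ K ∈ 𝒦, w K (s' ∩ K) := by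
          refine sum_congr rfl fun τ hτ => sum_congr rfl fun s' hs' => ?_
          rw [mem_powerset] at hτ hs'
          rw [prod_insert hK₀, union_inter_eq_left hτ (hΛ'.symm.mono_left hs')]
          congr 1
          refine prod_congr rfl fun K hK => ?_
          rw [union_inter_distrib_right, disjoint_iff_inter_eq_empty.1 ((hdisj' K hK).mono_left hτ), empty_union]
      _ = (∑ τ ∈ K₀.powerset, w K₀ τ) * 2 ^ F.card := by
          rw [sum_mul]
          exact sum_congr rfl fun τ _ => by rw [← mul_sum, ih']
      _ = 2 ^ F.card := by rw [hw K₀ (mem_insert_self _ _), one_mul]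

/-- **TOTAL MASS ONE**: the quenched weights of an admissible environment form a probability on `Λ.powerset`. -/
theorem quenchedProb_powerset {D Λ : Finset (Site 2)} (hD : D ⊆ innerVertices Λ) {v : Finset (Site 2) → Finset (Site 2)}
    (hv : v ∈ patterns D) : quenchedProb D Λ v Λ.powerset = 1 := by
  have hΛ := eq_freeCells_union_biUnion_comps (D := D) hD
  unfold quenchedProb
  calc ∑ s ∈ Λ.powerset, quenchedW D Λ v s
      = ∑ s ∈ Λ.powerset, ((1 : ℝ) / 2) ^ (freeCells D Λ).card *
          ∏ K ∈ comps D, chainW (localCode D K).card K (v K) (s ∩ K) :=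
        sum_congr rfl fun s hs => by rw [quenchedW, if_pos (mem_powerset.1 hs)]
    _ = ((1 : ℝ) / 2) ^ (freeCells D Λ).card *
          ∑ s ∈ (freeCells D Λ ∪ (comps D).biUnion id).powerset,
            ∏ K ∈ comps D, chainW (localCode D K).card K (v K) (s ∩ K) := by
        rw [← mul_sum, ← hΛ]
    _ = ((1 : ℝ) / 2) ^ (freeCells D Λ).card * 2 ^ (freeCells D Λ).card := by
        rw [sum_powerset_prod_blocks (freeCells D Λ) (fun K τ => chainW (localCode D K).card K (v K) τ) (comps D)
          (fun K hK K' hK' hne => comps_disjoint hK hK' hne) (fun K hK => disjoint_freeCells hK) fun K hK => ?_]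
        obtain ⟨h1, h2, h3⟩ := apply_mem_of_mem_patterns hv hK
        have hV := two_le_card_localCode hv hK
        exact sum_powerset_chainW (by omega) (mem_powerset.1 (mem_filter.1 h1).1) h2 h3
    _ = 1 := by rw [← mul_pow]; norm_num

/-! ## §4 Harris–FKG for two increasing families -/

/-- **QUENCHED HARRIS FOR TWO EVENTS**: for up-sets `A, B ⊆ Λ.powerset`, `P(A) P(B) ≤ P(A ∩ B)` — the Four Functions Theorem
on the powerset algebra of `Λ` with all four functions the log-supermodular quenched weight, `A ⊻ B ⊆ A ∩ B`, total mass `1`. -/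
theorem harris_two (hL : QuenchedLogSupermodular) {D Λ : Finset (Site 2)} (hD : D ⊆ innerVertices Λ)
    {v : Finset (Site 2) → Finset (Site 2)} (hv : v ∈ patterns D) {A B : Finset (Finset (Site 2))}
    (hA : A ⊆ Λ.powerset) (hA' : ∀ s ∈ A, ∀ t ⊆ Λ, s ⊆ t → t ∈ A)
    (hB : B ⊆ Λ.powerset) (hB' : ∀ s ∈ B, ∀ t ⊆ Λ, s ⊆ t → t ∈ B) :
    quenchedProb D Λ v A * quenchedProb D Λ v B ≤ quenchedProb D Λ v (Λ.powerset.filter fun s => s ∈ A ∧ s ∈ B) := by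
  have h0 : (0 : Finset (Site 2) → ℝ) ≤ quenchedW D Λ v := fun s => quenchedW_nonneg hv s
  have h4 := Finset.four_functions_theorem Λ h0 h0 h0 h0 (fun s _ t _ => hL D Λ hD v hv s t) hA hB
  have hZ := quenchedProb_powerset hD hv
  unfold quenchedProb at hZ ⊢
  refine h4.trans ?_
  calc (∑ s ∈ A ⊼ B, quenchedW D Λ v s) * ∑ s ∈ A ⊻ B, quenchedW D Λ v s
      ≤ (∑ s ∈ Λ.powerset, quenchedW D Λ v s) *
          ∑ s ∈ Λ.powerset.filter (fun s => s ∈ A ∧ s ∈ B), quenchedW D Λ v s := by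
        refine mul_le_mul ?_ ?_ (sum_nonneg fun _ _ => h0 _) (sum_nonneg fun _ _ => h0 _)
        · refine sum_le_sum_of_subset_of_nonneg ?_ fun _ _ _ => h0 _
          rw [← powerset_infs_powerset_self]
          exact infs_subset hA hB
        · refine sum_le_sum_of_subset_of_nonneg (fun u hu => ?_) fun _ _ _ => h0 _
          rw [mem_sups] at hu
          obtain ⟨a, ha, b, hb, rfl⟩ := hu
          have hab : a ∪ b ⊆ Λ := union_subset (mem_powerset.1 (hA ha)) (mem_powerset.1 (hB hb))
          rw [mem_filter, mem_powerset, sup_eq_union]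
          exact ⟨hab, hA' a ha _ hab subset_union_left, hB' b hb _ hab subset_union_right⟩
    _ = _ := by rw [hZ, one_mul]

end QuenchedHarrisProof

open QuenchedHarrisProof in
/-- **QUENCHED HARRIS–FKG** (registered stub `stub_quenchedHarris` of line `defect-closure-exploration` v7, layer (H) of the
quenched mixture): if every quenched weight is log-supermodular (L), then for finitely many increasing families `𝒜_i` of black
sets `∏_i P_ξ(𝒜_i) ≤ Z^{k−1} P_ξ(∩_i 𝒜_i)` (`Z = P_ξ(Λ.powerset) = 1`).  Induction on `k`, the step being `harris_two` applied to
the (increasing) intersection of the first `k` families and the last one. -/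
theorem stub_quenchedHarris : QuenchedLogSupermodular → QuenchedHarris := by
  intro hL D Λ hD v hv k
  induction k with
  | zero =>
    intro 𝒜 _
    simp [quenchedProb_powerset hD hv]
  | succ k ih =>
    intro 𝒜 h𝒜
    rw [Fin.prod_univ_castSucc, quenchedProb_powerset hD hv, one_pow, one_mul]
    have ih' := ih (fun i => 𝒜 (Fin.castSucc i)) fun i => h𝒜 _
    rw [quenchedProb_powerset hD hv, one_pow, one_mul] at ih'
    have hA' : ∀ s ∈ Λ.powerset.filter (fun s => ∀ i : Fin k, s ∈ 𝒜 (Fin.castSucc i)), ∀ t ⊆ Λ, s ⊆ t →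
        t ∈ Λ.powerset.filter fun s => ∀ i : Fin k, s ∈ 𝒜 (Fin.castSucc i) := by
      intro s hs t ht hst
      rw [mem_filter] at hs ⊢
      exact ⟨mem_powerset.2 ht, fun i => (h𝒜 _).2 s (hs.2 i) t ht hst⟩
    have h2 := harris_two hL hD hv (filter_subset _ _) hA' (h𝒜 (Fin.last k)).1 (h𝒜 (Fin.last k)).2
    have hfilter : (Λ.powerset.filter fun s =>
          (s ∈ Λ.powerset.filter fun s => ∀ i : Fin k, s ∈ 𝒜 (Fin.castSucc i)) ∧ s ∈ 𝒜 (Fin.last k)) =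
        Λ.powerset.filter fun s => ∀ i : Fin (k + 1), s ∈ 𝒜 i := by
      refine filter_congr fun s hs => ?_
      rw [mem_filter, Fin.forall_fin_succ']
      exact ⟨fun h => ⟨h.1.2, h.2⟩, fun h => ⟨⟨hs, h.1⟩, h.2⟩⟩
    rw [hfilter] at h2
    calc (∏ i : Fin k, quenchedProb D Λ v (𝒜 (Fin.castSucc i))) * quenchedProb D Λ v (𝒜 (Fin.last k))
        ≤ quenchedProb D Λ v (Λ.powerset.filter fun s => ∀ i : Fin k, s ∈ 𝒜 (Fin.castSucc i)) *
            quenchedProb D Λ v (𝒜 (Fin.last k)) :=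
          mul_le_mul_of_nonneg_right ih' (sum_nonneg fun s _ => quenchedW_nonneg hv s)
      _ ≤ _ := h2

/-- Exported alias of the registered stub: (L) ⇒ (H). -/
theorem quenchedHarris : QuenchedLogSupermodular → QuenchedHarris := stub_quenchedHarris

end Summit.CriticalPhenomena.CardyFormulaZ2.Cruxes.IKMixedBoxCrossing.QuenchedChainFKG

end
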